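import Summits.CriticalPhenomena.PercolationContinuityZ3.Theorems.PercNearOneGluingNoHeavyLowerTailMajorityGluingZFourteenEightP25
import Summits.CriticalPhenomena.PercolationContinuityZ3.Theorems.PercNearOneGluingNoHeavyLowerTailMajorityGluingZFourteenEightP26
import Summits.CriticalPhenomena.PercolationContinuityZ3.Theorems.PercNearOneGluingNoHeavyLowerTailMajorityGluingZFourteenEightP27
import Summits.CriticalPhenomena.PercolationContinuityZ3.Theorems.PercNearOneGluingNoHeavyLowerTailMajorityGluingZFourteenEightP28
import Summits.CriticalPhenomena.PercolationContinuityZ3.Theorems.PercNearOneGluingNoHeavyLowerTailMajorityGluingZFourteenEightP29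
import Summits.CriticalPhenomena.PercolationContinuityZ3.Theorems.PercNearOneGluingNoHeavyLowerTailMajorityGluingZFourteenEightP30
import Summits.CriticalPhenomena.PercolationContinuityZ3.Theorems.PercNearOneGluingNoHeavyLowerTailMajorityGluingZFourteenEightP31
import Summits.CriticalPhenomena.PercolationContinuityZ3.Theorems.PercNearOneGluingNoHeavyLowerTailMajorityGluingZFourteenEightP32
import Summits.CriticalPhenomena.PercolationContinuityZ3.Theorems.PercNearOneGluingNoHeavyLowerTailMajorityGluingZFourteenEightP33
import Summits.CriticalPhenomena.PercolationContinuityZ3.Theorems.PercNearOneGluingNoHeavyLowerTailMajorityGluingZFourteenEightP34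
import Summits.CriticalPhenomena.PercolationContinuityZ3.Theorems.PercNearOneGluingNoHeavyLowerTailMajorityGluingZFourteenEightP35
import Summits.CriticalPhenomena.PercolationContinuityZ3.Theorems.PercNearOneGluingNoHeavyLowerTailMajorityGluingZFourteenEightP36
import Summits.CriticalPhenomena.PercolationContinuityZ3.Theorems.PercNearOneGluingNoHeavyLowerTailMajorityGluingZFourteenEightHG3C1
import Summits.CriticalPhenomena.PercolationContinuityZ3.Theorems.PercNearOneGluingNoHeavyLowerTailMajorityGluingZFourteenEightHG3C2
import Summits.CriticalPhenomena.PercolationContinuityZ3.Theorems.PercNearOneGluingNoHeavyLowerTailMajorityGluingZFourteenEightHG3C3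
import Summits.CriticalPhenomena.PercolationContinuityZ3.Theorems.PercNearOneGluingNoHeavyLowerTailMajorityGluingZFourteenEightHG3C4
import Summits.CriticalPhenomena.PercolationContinuityZ3.Theorems.PercNearOneGluingNoHeavyLowerTailMajorityGluingZFourteenEightHG3C5
import Summits.CriticalPhenomena.PercolationContinuityZ3.Theorems.PercNearOneGluingNoHeavyLowerTailMajorityGluingZFourteenEightHG3C6
import Summits.CriticalPhenomena.PercolationContinuityZ3.Theorems.PercNearOneGluingNoHeavyLowerTailMajorityGluingZRangeAM
import HarnessLib

/-!
# Group 3 of 7 of the `(14,8)` certificate at `c = 3/2`: its aggregate-merge tree IS the concatenation of its 6 key-range chunks (lane prim-rate, constants-miner 1, gen 39; cert/mkhier.py)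

Support file for the closed crux `NoHeavyLowerTail` (stmt-CriticalPhenomena-4575), majority-gluing line.  The 12 parts P25, P26, P27, P28, P29, P30, P31, P32, P33, P34, P35, P36 (kit j310356) carry verified
type-space digests `…D`; `fourteenEightT2G3T` is their binary tree of aggregated merges (`am`, …MajorityGluingZRangeAM, depth 4); the kernel verifies `fourteenEightT2G3T = [chunks].flatten`
(`fourteenEightT2G3_eq`), and `fourteenEightT2G3_val` identifies the value of the group's digests with the value of its chunks (`evalC_am`).  No sorries. [cite: VandenbergKahn2001, Thm 1.2 (p. 123)]
-/

namespace Summit.CriticalPhenomena.PercolationContinuityZ3.Theorems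

namespace HubOnly
namespace QCert

/-- The aggregate-merge tree of group 3. -/
def fourteenEightT2G3T : List (ℕ × ℤ) :=
  am (am (am (am (fourteenEightTP25D) (fourteenEightTP26D)) (am (fourteenEightTP27D) (fourteenEightTP28D))) (am (am (fourteenEightTP29D) (fourteenEightTP30D)) (am (fourteenEightTP31D) (fourteenEightTP32D)))) (am (am (fourteenEightTP33D) (fourteenEightTP34D)) (am (fourteenEightTP35D) (fourteenEightTP36D)))

set_option maxRecDepth 8192 in
set_option maxHeartbeats 0 in
/-- **The tree of group 3 equals the concatenation of its key-range chunks** (kernel evaluation). -/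
theorem fourteenEightT2G3_eq : fourteenEightT2G3T = [fourteenEightT2G3C1, fourteenEightT2G3C2, fourteenEightT2G3C3, fourteenEightT2G3C4, fourteenEightT2G3C5, fourteenEightT2G3C6].flatten := by
  decide +kernel

/-- The tree's value is the value of the group's digests. -/
theorem fourteenEightT2G3_treeVal (val : ℕ → ℝ) : evalC val fourteenEightT2G3T = evalC val [fourteenEightTP25D, fourteenEightTP26D, fourteenEightTP27D, fourteenEightTP28D, fourteenEightTP29D, fourteenEightTP30D, fourteenEightTP31D, fourteenEightTP32D, fourteenEightTP33D, fourteenEightTP34D, fourteenEightTP35D, fourteenEightTP36D].flatten := by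
  simp only [fourteenEightT2G3T, evalC_am, List.flatten_cons, List.flatten_nil, evalC_append, evalC_nil', add_assoc, add_zero]

/-- **The value of group 3's digests is the value of its chunks.** -/
theorem fourteenEightT2G3_val (val : ℕ → ℝ) : evalC val [fourteenEightTP25D, fourteenEightTP26D, fourteenEightTP27D, fourteenEightTP28D, fourteenEightTP29D, fourteenEightTP30D, fourteenEightTP31D, fourteenEightTP32D, fourteenEightTP33D, fourteenEightTP34D, fourteenEightTP35D, fourteenEightTP36D].flatten = evalC val [fourteenEightT2G3C1, fourteenEightT2G3C2, fourteenEightT2G3C3, fourteenEightT2G3C4, fourteenEightT2G3C5, fourteenEightT2G3C6].flatten := by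
  rw [← fourteenEightT2G3_treeVal val, fourteenEightT2G3_eq]

end QCert
end HubOnly

end Summit.CriticalPhenomena.PercolationContinuityZ3.Theorems
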